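import Summits.Ventures.PercRepro.RankLevelSetBoolInOut
import Mathlib.Combinatorics.SetFamily.Shadow

/-! # RankLevelSetBoolInOutStrong — THE STAR-NORMALIZED STEP: `(n − k) · v_k ≤ k · v_{k+1}` FOR EVERY INTERSECTING
UP-SET (`2k ≤ n`), AND THE UPPER-SHADOW COROLLARY FOR `k`-UNIFORM INTERSECTING FAMILIES (night-1 g33; dossier §45.10)

The step of the Boolean (IO) (`RankLevelSetBoolInOut`, `(n + 1 − k) v_k ≤ (k + 1) v_{k+1}`) is implied by the STRONGER
`(n − k) · v_k ≤ k · v_{k+1}` («the density relative to the star, `v_k / C(n−1, k−1)`, is nondecreasing up to the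
middle»; the star is tight at EVERY `k`), whose cycle-method proof is even shorter: per cyclic order the member
`(k+1)`-arcs contain the two `(k+1)`-arcs around every member `k`-arc, so `#S_{k+1} ≥ #S_k + 1` when `S_k ≠ ∅`
(**`card_memberStarts_succ_ge`**), and with Katona's `#S_k ≤ k` this is `(k + 1) · #S_k ≤ k · #S_{k+1}`
(**`succ_mul_card_memberStarts_le`**); averaged with `#fib(k) · C(n, k) = #fib(k+1) · C(n, k+1)` it is the claim
(**`strong_step_levelCount`**). In complement form it is Katona's 1964 intersecting-shadow ratio theorem
(`|∂_{m−1} 𝒢| ≥ |𝒢| · m / (m − t + 1)` for a `t`-intersecting `m`-uniform `𝒢`, with `m = n − k`, `t = n − 2k + 1`),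
re-derived by the cycle method; in its own form: for every intersecting family `F` of `k`-subsets of `[n]` with
`2k ≤ n`, **`card_upShadow_ge_of_intersecting`**: `(n − k) · #F ≤ k · #(∂⁺ F)`. Every declaration has a docstring;
imports: the cell's own modules and Mathlib only. Axioms: standard. -/

namespace PercRepro

namespace Cycle

open Finset

variable {α : Type} [Fintype α] [DecidableEq α] {n : ℕ} [NeZero n]

/-- **The member `(k+1)`-arcs outnumber the member `k`-arcs**: for an up-set `V` and `2k ≤ n` (so that
`#S_k ≤ k < n`), `#memberStarts V σ k + 1 ≤ #memberStarts V σ (k + 1)` whenever `memberStarts V σ k ≠ ∅`: the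
`(k+1)`-arcs starting at `s` and at `s − 1` contain the member `k`-arc at `s`, and `S_k ∪ (S_k − 1)` is strictly
larger than `S_k` unless `S_k` is everything. -/
lemma card_memberStarts_succ_ge {V : Finset (Finset α)} (hV : (V : Set (Finset α)).Intersecting)
    (hup : IsUpperSet (V : Set (Finset α))) (σ : ZMod n ≃ α) {k : ℕ} (hk : 2 * k ≤ n)
    (hne : (memberStarts V σ k).Nonempty) :
    (memberStarts V σ k).card + 1 ≤ (memberStarts V σ (k + 1)).card := by
  -- `S_k ∪ (S_k − 1) ⊆ S_{k+1}`
  have hsub : grow ((memberStarts V σ k).image (· - 1)) ⊆ memberStarts V σ (k + 1) := by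
    intro u hu
    rcases Finset.mem_union.mp hu with h | h
    · obtain ⟨s, hs, rfl⟩ := Finset.mem_image.mp h
      rw [mem_memberStarts] at hs ⊢
      have : arc σ (s - 1 + 1) k ⊆ arc σ (s - 1) (k + 1) := arc_add_one_subset_arc_succ σ (s - 1) k
      rw [sub_add_cancel] at this
      exact hup (Finset.coe_subset.mpr this) hs
    · obtain ⟨v, hv, rfl⟩ := Finset.mem_image.mp h
      obtain ⟨s, hs, rfl⟩ := Finset.mem_image.mp hv
      rw [mem_memberStarts] at hs ⊢
      rw [sub_add_cancel]
      exact hup (Finset.coe_subset.mpr (arc_subset_arc_succ σ s k)) hs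
  have hcardA : ((memberStarts V σ k).image (· - 1)).card = (memberStarts V σ k).card :=
    Finset.card_image_of_injective _ (sub_left_injective)
  have hAne : ((memberStarts V σ k).image (· - 1)).Nonempty := hne.image _
  have hgrow := card_grow hAne
  rw [hcardA] at hgrow
  have hkat := card_memberStarts_le_of_intersecting hV σ hk
  have hkn : k < n := by have := NeZero.pos n; omega
  have hmin : min n ((memberStarts V σ k).card + 1) = (memberStarts V σ k).card + 1 := by omega
  rw [hmin] at hgrow
  exact hgrow.trans (Finset.card_le_card hsub)

/-- **THE PER-CYCLE STAR-NORMALIZED STEP**: `(k + 1) · #S_k ≤ k · #S_{k+1}` for an intersecting up-set, `2k ≤ n`. -/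
theorem succ_mul_card_memberStarts_le {V : Finset (Finset α)} (hV : (V : Set (Finset α)).Intersecting)
    (hup : IsUpperSet (V : Set (Finset α))) (σ : ZMod n ≃ α) {k : ℕ} (hk : 2 * k ≤ n) :
    (k + 1) * (memberStarts V σ k).card ≤ k * (memberStarts V σ (k + 1)).card := by
  rcases (memberStarts V σ k).eq_empty_or_nonempty with hS | hne
  · rw [hS]; simp
  have h1 := card_memberStarts_succ_ge hV hup σ hk hne
  have hkat := card_memberStarts_le_of_intersecting hV σ hk
  calc (k + 1) * (memberStarts V σ k).card = k * (memberStarts V σ k).card + (memberStarts V σ k).card := by ring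
    _ ≤ k * (memberStarts V σ k).card + k := Nat.add_le_add_left hkat _
    _ = k * ((memberStarts V σ k).card + 1) := by ring
    _ ≤ k * (memberStarts V σ (k + 1)).card := Nat.mul_le_mul_left _ h1

/-- **THE STAR-NORMALIZED STEP OF THE BOOLEAN (IO)**: `(n − k) · v_k ≤ k · v_{k+1}` for every intersecting up-set
`V` and `2k ≤ n`; the per-cycle inequality averaged with `#fib(k) · C(n, k) = #fib(k+1) · C(n, k+1) = #pairs` and
`(n − k) · C(n, k) = (k + 1) · C(n, k + 1)`. -/
theorem strong_step_levelCount (hn : Fintype.card α = n) {V : Finset (Finset α)}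
    (hV : (V : Set (Finset α)).Intersecting) (hup : IsUpperSet (V : Set (Finset α))) {k : ℕ}
    (hk : 2 * k ≤ n) : (n - k) * levelCount V k ≤ k * levelCount V (k + 1) := by
  have hkn : k < n := by have := NeZero.pos n; omega
  obtain ⟨K₀, hK₀⟩ := exists_card_eq hn (k := k) hkn.le
  obtain ⟨K₁, hK₁⟩ := exists_card_eq hn (k := k + 1) hkn
  have hsum : ∑ σ : ZMod n ≃ α, (k + 1) * (memberStarts V σ k).card ≤
      ∑ σ : ZMod n ≃ α, k * (memberStarts V σ (k + 1)).card :=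
    Finset.sum_le_sum fun σ _ => succ_mul_card_memberStarts_le hV hup σ hk
  rw [← Finset.mul_sum, ← Finset.mul_sum, sum_card_memberStarts V hkn.le hK₀,
    sum_card_memberStarts V hkn hK₁] at hsum
  have hc₀ := card_fib_mul_choose hn hkn.le hK₀
  have hc₁ := card_fib_mul_choose hn hkn hK₁
  have hch : n.choose (k + 1) * (k + 1) = n.choose k * (n - k) := Nat.choose_succ_right_eq n k
  have hcpos : 0 < Fintype.card (Pairs α n) := @Fintype.card_pos _ _ (nonempty_pairs hn)
  have hchpos : 0 < n.choose (k + 1) := Nat.choose_pos hkn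
  have key : levelCount V k * (n - k) * (Fintype.card (Pairs α n) * n.choose (k + 1)) ≤
      levelCount V (k + 1) * k * (Fintype.card (Pairs α n) * n.choose (k + 1)) := by
    calc levelCount V k * (n - k) * (Fintype.card (Pairs α n) * n.choose (k + 1))
        = levelCount V k * (n - k) * (((fib n k K₀).card * n.choose k) * n.choose (k + 1)) := by rw [hc₀]
      _ = levelCount V k * (fib n k K₀).card * (n.choose k * (n - k)) * n.choose (k + 1) := by ring
      _ = levelCount V k * (fib n k K₀).card * (n.choose (k + 1) * (k + 1)) * n.choose (k + 1) := by rw [hch]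
      _ = ((k + 1) * (levelCount V k * (fib n k K₀).card)) * (n.choose (k + 1) * n.choose (k + 1)) := by ring
      _ ≤ (k * (levelCount V (k + 1) * (fib n (k + 1) K₁).card)) * (n.choose (k + 1) * n.choose (k + 1)) :=
          Nat.mul_le_mul_right _ hsum
      _ = levelCount V (k + 1) * k * (((fib n (k + 1) K₁).card * n.choose (k + 1)) * n.choose (k + 1)) := by ring
      _ = levelCount V (k + 1) * k * (Fintype.card (Pairs α n) * n.choose (k + 1)) := by rw [hc₁]
  have := Nat.le_of_mul_le_mul_right key (by positivity)
  calc (n - k) * levelCount V k = levelCount V k * (n - k) := by ring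
    _ ≤ levelCount V (k + 1) * k := this
    _ = k * levelCount V (k + 1) := by ring

end Cycle

/-! ## The upper-shadow corollary -/

namespace Cycle

open Finset

variable {α : Type} [Fintype α] [DecidableEq α]

/-- The up-closure of a family `F` of finsets: the sets containing a member of `F`. -/
def upClosure (F : Finset (Finset α)) : Finset (Finset α) := univ.filter (fun W => ∃ A ∈ F, A ⊆ W)

/-- Membership in the up-closure. -/
lemma mem_upClosure {F : Finset (Finset α)} {W : Finset α} : W ∈ upClosure F ↔ ∃ A ∈ F, A ⊆ W := by
  simp [upClosure]

/-- The up-closure is an up-set. -/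
lemma isUpperSet_upClosure (F : Finset (Finset α)) : IsUpperSet ((upClosure F : Finset (Finset α)) : Set (Finset α)) := by
  intro W₁ W₂ hle h
  rw [Finset.mem_coe, mem_upClosure] at h ⊢
  obtain ⟨A, hA, hAW⟩ := h
  exact ⟨A, hA, hAW.trans hle⟩

/-- The up-closure of an intersecting family is intersecting. -/
lemma intersecting_upClosure {F : Finset (Finset α)} (hF : (F : Set (Finset α)).Intersecting) :
    ((upClosure F : Finset (Finset α)) : Set (Finset α)).Intersecting := by
  intro W₁ hW₁ W₂ hW₂ hdis
  rw [Finset.mem_coe, mem_upClosure] at hW₁ hW₂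
  obtain ⟨A₁, hA₁, h₁⟩ := hW₁
  obtain ⟨A₂, hA₂, h₂⟩ := hW₂
  exact hF (Finset.mem_coe.mpr hA₁) (Finset.mem_coe.mpr hA₂) (Finset.disjoint_of_subset_left h₁
    (Finset.disjoint_of_subset_right h₂ hdis))

/-- The `k`-members of the up-closure of a `k`-uniform family are the family itself. -/
lemma levelCount_upClosure_self {F : Finset (Finset α)} {k : ℕ} (hF : Set.Sized k (F : Set (Finset α))) :
    levelCount (upClosure F) k = F.card := by
  unfold levelCount
  congr 1
  ext W
  rw [Finset.mem_filter, mem_upClosure]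
  constructor
  · rintro ⟨⟨A, hA, hAW⟩, hW⟩
    have hAk : A.card = k := hF (Finset.mem_coe.mpr hA)
    rw [← Finset.eq_of_subset_of_card_le hAW (by rw [hW, hAk])]
    exact hA
  · intro hW
    exact ⟨⟨W, hW, Finset.Subset.refl W⟩, hF (Finset.mem_coe.mpr hW)⟩

/-- The `(k+1)`-members of the up-closure of a `k`-uniform family are its upper shadow. -/
lemma levelCount_upClosure_succ {F : Finset (Finset α)} {k : ℕ} (hF : Set.Sized k (F : Set (Finset α))) :
    levelCount (upClosure F) (k + 1) = (Finset.upShadow F).card := by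
  unfold levelCount
  congr 1
  ext W
  rw [Finset.mem_filter, mem_upClosure, Finset.mem_upShadow_iff]
  constructor
  · rintro ⟨⟨A, hA, hAW⟩, hW⟩
    have hAk : A.card = k := hF (Finset.mem_coe.mpr hA)
    have hne : A ≠ W := fun h => by rw [h] at hAk; omega
    obtain ⟨a, haW, haA⟩ := Finset.exists_of_ssubset (Finset.ssubset_iff_subset_ne.mpr ⟨hAW, hne⟩)
    refine ⟨A, hA, a, haA, ?_⟩
    apply Finset.eq_of_subset_of_card_le (Finset.insert_subset haW hAW)
    rw [Finset.card_insert_of_notMem haA, hAk, hW]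
  · rintro ⟨A, hA, a, haA, rfl⟩
    refine ⟨⟨A, hA, Finset.subset_insert a A⟩, ?_⟩
    rw [Finset.card_insert_of_notMem haA, hF (Finset.mem_coe.mpr hA)]

/-- **THE UPPER SHADOW OF AN INTERSECTING `k`-UNIFORM FAMILY** (Katona's ratio, by the cycle method): for an
intersecting family `F` of `k`-subsets of a finite type with `n` elements and `2k ≤ n`,
`(n − k) · #F ≤ k · #(∂⁺ F)`; the star `{A ∋ x}` is tight. -/
theorem card_upShadow_ge_of_intersecting {n : ℕ} (hn : Fintype.card α = n) {F : Finset (Finset α)}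
    (hF : (F : Set (Finset α)).Intersecting) {k : ℕ} (hFk : Set.Sized k (F : Set (Finset α))) (hk : 2 * k ≤ n) :
    (n - k) * F.card ≤ k * (Finset.upShadow F).card := by
  rcases Nat.eq_zero_or_pos n with rfl | hpos
  · have hk0 : k = 0 := by omega
    subst hk0
    have : F = ∅ := by
      rw [Finset.eq_empty_iff_forall_notMem]
      intro A hA
      have := hFk (Finset.mem_coe.mpr hA)
      rw [Finset.card_eq_zero] at this
      exact hF.bot_notMem (by rw [Finset.bot_eq_empty, Finset.mem_coe, ← this]; exact hA)
    simp [this]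
  haveI : NeZero n := ⟨hpos.ne'⟩
  have := strong_step_levelCount hn (intersecting_upClosure hF) (isUpperSet_upClosure F) hk
  rwa [levelCount_upClosure_self hFk, levelCount_upClosure_succ hFk] at this

end Cycle

end PercRepro
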